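import Literature.Computability.AlgebraicComplexity.IsotypicOccurrenceSemigroup
import Literature.Computability.AlgebraicComplexity.QuantumFunctionalPoint
import HarnessLib

/-!
# The quantum functionals are monotone under inclusion of moment polytopes (occurrence domination)

Topic `Computability/AlgebraicComplexity`; proofs file (theorems only, no definitions, no named
facts), companion of `IsotypicOccurrenceSemigroup.lean` / `UnitTensorMomentPolytope.lean`. The
quantum functionals of Christandl–Vrana–Zuiddam "are defined as entropy maximizations over the
moment polytope `Δ(T)`" [vandenBergChristandlLysikovNieuwboerWalterZuiddam2025, §1]; in the tree's
coordinates, CVZ Thm. 3.30 (`upperLogQuantumFunctional_eq_logQuantumFunctional`, PROVED in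
`QuantumFunctionalsUpperEqLower.lean`) says `E_θ(t) = E^θ(t)`, the supremum of the `θ`-weighted
entropies `∑ θⱼ H(λ̄⁽ʲ⁾)` over the tuples admissible for `t` in the sense of Def. 3.3 (isotypic
projectors on the legs in `supp θ` do not kill `t^{⊗n}`). Consequently `F_θ` only depends on the set
of OCCURRING partition triples up to scaling, i.e. on the moment polytope in its
representation-theoretic description, monotonically. This file PROVES that consequence in the exact
"domination" form used by route `MatrixMultiplication/IsotypicSaturation` (whose hypothesis shape is
that of the named fact `vandenBergEtAl2025_unitTensor_four_polytope_maximal`):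

* `upperLogQuantumFunctional_le_of_dominated` (`θ ≥ 0`), `logQuantumFunctional_le_of_dominated`,
  `quantumFunctional_le_of_dominated`, `quantumFunctionalPoint_le_of_dominated` (`θ` in the
  probability simplex): **if every partition triple `λ ⊢ n` occurring in `s^{⊗n}` has a multiple
  `kλ` occurring in `t^{⊗kn}`, then `E^θ(s) ≤ E^θ(t)`, `E_θ(s) ≤ E_θ(t)`, `F_θ(s) ≤ F_θ(t)`** — for
  tensors `s`, `t` of arbitrary (possibly different) finite formats.

Ingredients (§2): an admissible tuple extends to an occurring full triple agreeing with it on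
`supp θ` (`exists_occurring_of_upperAdmissible`, from `exists_full_triple`: `1 = ∑_ν P_ν` on the
other legs), an occurring triple is admissible for every `θ` (`upperAdmissible_of_occurring`), both
transported from alphabets `Fin a` by relabelling; scaling a triple does not change normalised
entropies (§1); a nonzero tensor has an occurring triple in degree `1`, so domination forces `t ≠ 0`
when `s ≠ 0` (for `F_θ = 2^{E_θ}` off `0`).

## References

* [ChristandlVranaZuiddam2023] M. Christandl, P. Vrana, J. Zuiddam, *Universal points in the
  asymptotic spectrum of tensors*, J. Amer. Math. Soc. 36 (2023) = arXiv:1709.07851v3, Def. 3.3,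
  Def. 3.16, Thm. 3.30, Cor. 3.31.
* [vandenBergChristandlLysikovNieuwboerWalterZuiddam2025] M. van den Berg et al., arXiv:2503.22633,
  §1 ("a family of ≲-monotone functions … the quantum functionals … defined as entropy
  maximizations over the moment polytope `Δ(T)`").
-/

noncomputable section

open scoped BigOperators
open Real (negMulLog)

namespace Literature.Computability.AlgebraicComplexity

open Literature.RepresentationTheory.FiniteGroups (wordIsotypicMatrix)

/-! ## §1 Entropies of scaled partitions -/

section Entropy

variable {n : ℕ}

/-- Scaling a partition (`parts ↦ c · parts`, `n ↦ c n`, `c ≥ 1`) does not change its normalised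
entropy `H(λ̄)`: `(cλᵢ)/(cn) = λᵢ/n`. [folklore] -/
theorem partitionEntropy_eq_of_parts_eq_map_mul {c M : ℕ} (hc : 0 < c) (hM : M = c * n)
    {P : Nat.Partition M} {lam : Nat.Partition n} (hP : P.parts = lam.parts.map (fun p => c * p)) :
    partitionEntropy P = partitionEntropy lam := by
  subst hM
  rw [partitionEntropy_def, partitionEntropy_def, hP, Multiset.map_map]
  congr 2
  refine Multiset.map_congr rfl fun p _ => ?_
  simp only [Function.comp_apply, Nat.cast_mul]
  rw [mul_div_mul_left _ _ (Nat.cast_ne_zero.2 hc.ne')]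

/-- The `θ`-weighted entropy of a scaled triple equals that of the triple. [folklore] -/
theorem weightedPartitionEntropy_eq_of_parts_eq_map_mul (θ : Fin 3 → ℝ) {c M : ℕ} (hc : 0 < c)
    (hM : M = c * n) {mu : Fin 3 → Nat.Partition M} {lam : Fin 3 → Nat.Partition n}
    (hmu : ∀ j, (mu j).parts = (lam j).parts.map (fun p => c * p)) :
    weightedPartitionEntropy θ mu = weightedPartitionEntropy θ lam := by
  simp only [weightedPartitionEntropy, partitionEntropy_eq_of_parts_eq_map_mul hc hM (hmu 0),
    partitionEntropy_eq_of_parts_eq_map_mul hc hM (hmu 1),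
    partitionEntropy_eq_of_parts_eq_map_mul hc hM (hmu 2)]

/-- Triples agreeing on the support of `θ` have the same `θ`-weighted entropy. [folklore] -/
theorem weightedPartitionEntropy_congr_support (θ : Fin 3 → ℝ) {lam lam' : Fin 3 → Nat.Partition n}
    (h : ∀ j, θ j ≠ 0 → lam' j = lam j) :
    weightedPartitionEntropy θ lam' = weightedPartitionEntropy θ lam := by
  unfold weightedPartitionEntropy
  have t : ∀ j, θ j * partitionEntropy (lam' j) = θ j * partitionEntropy (lam j) := by
    intro j
    by_cases hj : θ j = 0
    · rw [hj, zero_mul, zero_mul]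
    · rw [h j hj]
  rw [t 0, t 1, t 2]

end Entropy

/-! ## §2 Admissible tuples and occurring triples (arbitrary finite index types) -/

section Admissible

variable {ι κ μ : Type} [Fintype ι] [Fintype κ] [Fintype μ] {n : ℕ}

/-- The relabelled tensor of `QuantumFunctionalsSpectrumEstimation.lean` is the letter relabelling.
[folklore] -/
theorem actTensor_relabel_eq [DecidableEq ι] [DecidableEq κ] [DecidableEq μ]
    (e₁ : ι ≃ Fin (Fintype.card ι)) (e₂ : κ ≃ Fin (Fintype.card κ)) (e₃ : μ ≃ Fin (Fintype.card μ))
    (t : ι → κ → μ → ℂ) :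
    actTensor ((1 : Matrix ι ι ℂ).submatrix (⇑e₁.symm) id) ((1 : Matrix κ κ ℂ).submatrix (⇑e₂.symm) id)
      ((1 : Matrix μ μ ℂ).submatrix (⇑e₃.symm) id) t =
      fun i j k => t (e₁.symm i) (e₂.symm j) (e₃.symm k) := by
  funext i j k
  exact actTensor_relabel_apply e₁ e₂ e₃ t i j k

/-- **An admissible tuple of Def. 3.3 extends to an occurring full triple**: if `(λ⁽ʲ⁾)ⱼ` is
admissible for `s` (the projectors on the legs in `supp θ` do not kill `s^{⊗n}`) then, completing the
legs outside `supp θ` with `1 = ∑_ν P_ν`, some full triple agreeing with `λ` on `supp θ` occurs in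
`s^{⊗n}`. [cite: ChristandlVranaZuiddam2023, Def. 3.3 and §3.1 (sw)] -/
theorem exists_occurring_of_upperAdmissible (θ : Fin 3 → ℝ) {s : ι → κ → μ → ℂ}
    {lam : Fin 3 → Nat.Partition n} (hadm : UpperAdmissible θ s n lam) :
    ∃ lam' : Fin 3 → Nat.Partition n, (∀ j, θ j ≠ 0 → lam' j = lam j) ∧
      isotypicSum₁ (lam' 0) (isotypicSum₂ (lam' 1) (isotypicSum₃ (lam' 2) (kroneckerPow s n))) ≠ 0 := by
  classical
  set e₁ := Fintype.equivFin ι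
  set e₂ := Fintype.equivFin κ
  set e₃ := Fintype.equivFin μ
  have hadm' := (upperAdmissible_actTensor_relabel_iff e₁ e₂ e₃ θ s lam).2 hadm
  rw [actTensor_relabel_eq] at hadm'
  set s' : Fin (Fintype.card ι) → Fin (Fintype.card κ) → Fin (Fintype.card μ) → ℂ :=
    fun i j k => s (e₁.symm i) (e₂.symm j) (e₃.symm k) with hs'
  obtain ⟨z, hz, heq⟩ := upperProjection_eq_smul_actTensor θ lam (kroneckerPow s' n)
  have hM : actTensor (if θ 0 = 0 then 1 else wordIsotypicMatrix _ n (lam 0))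
      (if θ 1 = 0 then 1 else wordIsotypicMatrix _ n (lam 1))
      (if θ 2 = 0 then 1 else wordIsotypicMatrix _ n (lam 2)) (kroneckerPow s' n) ≠ 0 := by
    intro h0
    apply hadm'
    show upperProjection θ lam (kroneckerPow s' n) = 0
    rw [heq, h0, smul_zero]
  obtain ⟨lam', hlam', hne⟩ := exists_full_triple θ lam hM
  refine ⟨lam', hlam', ?_⟩
  rw [← isotypicSum₁₂₃_kroneckerPow_ne_zero_relabel_iff s e₁ e₂ e₃, isotypicSum₁₂₃_ne_zero_iff]
  exact hne

/-- **An occurring triple is admissible** (for every `θ`): if `λ` occurs in `t^{⊗n}` then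
`(λ⁽ʲ⁾)ⱼ` is admissible for `t` in the sense of Def. 3.3. [cite: ChristandlVranaZuiddam2023, Def. 3.3] -/
theorem upperAdmissible_of_occurring (θ : Fin 3 → ℝ) {t : ι → κ → μ → ℂ}
    {lam : Fin 3 → Nat.Partition n}
    (h : isotypicSum₁ (lam 0) (isotypicSum₂ (lam 1) (isotypicSum₃ (lam 2) (kroneckerPow t n))) ≠ 0) :
    UpperAdmissible θ t n lam := by
  classical
  set e₁ := Fintype.equivFin ι
  set e₂ := Fintype.equivFin κ
  set e₃ := Fintype.equivFin μ
  rw [← isotypicSum₁₂₃_kroneckerPow_ne_zero_relabel_iff t e₁ e₂ e₃, isotypicSum₁₂₃_ne_zero_iff] at h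
  have hadm' := upperAdmissible_of_actTensor_wordIsotypicMatrix_ne_zero θ h
  rw [← upperAdmissible_actTensor_relabel_iff e₁ e₂ e₃ θ t lam, actTensor_relabel_eq]
  exact hadm'

/-- A nonzero tensor has an occurring triple in degree `1` (`∑_λ P_λ = 1`). [folklore] -/
theorem exists_occurring_one_of_ne_zero {s : ι → κ → μ → ℂ} (hs : s ≠ 0) :
    ∃ lam : Fin 3 → Nat.Partition 1,
      isotypicSum₁ (lam 0) (isotypicSum₂ (lam 1) (isotypicSum₃ (lam 2) (kroneckerPow s 1))) ≠ 0 := by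
  classical
  -- admissibility for `θ = 0` is just `s^{⊗1} ≠ 0`
  have hpow : kroneckerPow s 1 ≠ 0 := by
    intro h0
    apply hs
    funext a b c
    have := congrFun (congrFun (congrFun h0 (fun _ => a)) (fun _ => b)) (fun _ => c)
    simpa [kroneckerPow_apply] using this
  have hadm : UpperAdmissible (fun _ : Fin 3 => (0 : ℝ)) s 1 (fun _ => Nat.Partition.indiscrete 1) := by
    unfold UpperAdmissible upperProjection
    simpa using hpow
  obtain ⟨lam', -, hocc⟩ := exists_occurring_of_upperAdmissible (fun _ : Fin 3 => (0 : ℝ)) hadm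
  exact ⟨lam', hocc⟩

end Admissible

/-! ## §3 Monotonicity of the quantum functionals under occurrence domination -/

section Monotone

variable {ι κ μ ι' κ' μ' : Type} [Fintype ι] [Fintype κ] [Fintype μ] [Fintype ι'] [Fintype κ']
  [Fintype μ']

/-- **`E^θ` is monotone under domination of occurring triples** (`θ ≥ 0`): if every partition triple
occurring in a power `s^{⊗n}` has a multiple `kλ` occurring in `t^{⊗kn}` — i.e. `Δ(s) ⊆ Δ(t)` for the
moment polytopes in their representation-theoretic description — then `E^θ(s) ≤ E^θ(t)`. Indeed
`E^θ(s)` is a supremum of `θ`-weighted entropies of admissible tuples (CVZ Def. 3.3), every admissible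
tuple extends to an occurring triple with the same weighted entropy, its multiple `kλ` occurs in
`t^{⊗kn}`, is admissible for `t`, and has the same normalised entropies. This is the monotonicity of
`F^θ(T) = max_{p ∈ Δ(T)} 2^{⟨θ, H(p)⟩}` under inclusion of moment polytopes (CVZ Thm. 3.30 / Cor. 3.31
with the description of `Δ` by occurring highest weights; vdBCLNWZ 2025 §1).
[cite: ChristandlVranaZuiddam2023, Def. 3.3 and Thm. 3.30]
[cite: vandenBergChristandlLysikovNieuwboerWalterZuiddam2025, §1] -/
theorem upperLogQuantumFunctional_le_of_dominated {θ : Fin 3 → ℝ} (hθ : ∀ j, 0 ≤ θ j)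
    {s : ι → κ → μ → ℂ} {t : ι' → κ' → μ' → ℂ}
    (hdom : ∀ (n : ℕ) (lam : Fin 3 → Nat.Partition n), 0 < n →
      isotypicSum₁ (lam 0) (isotypicSum₂ (lam 1) (isotypicSum₃ (lam 2) (kroneckerPow s n))) ≠ 0 →
      ∃ (k : ℕ) (mu : Fin 3 → Nat.Partition (k * n)), 0 < k ∧
        (∀ j, (mu j).parts = (lam j).parts.map (fun p => k * p)) ∧
        isotypicSum₁ (mu 0) (isotypicSum₂ (mu 1) (isotypicSum₃ (mu 2) (kroneckerPow t (k * n)))) ≠ 0) :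
    upperLogQuantumFunctional θ s ≤ upperLogQuantumFunctional θ t := by
  refine Real.sSup_le ?_ (upperLogQuantumFunctional_nonneg hθ t)
  rintro _ ⟨n, lam, hn, hadm, rfl⟩
  obtain ⟨lam', hlam', hocc⟩ := exists_occurring_of_upperAdmissible θ hadm
  obtain ⟨k, mu, hk, hmu, hocct⟩ := hdom n lam' hn hocc
  have hadmt : UpperAdmissible θ t (k * n) mu := upperAdmissible_of_occurring θ hocct
  calc weightedPartitionEntropy θ lam
      = weightedPartitionEntropy θ lam' := (weightedPartitionEntropy_congr_support θ hlam').symm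
    _ = weightedPartitionEntropy θ mu := (weightedPartitionEntropy_eq_of_parts_eq_map_mul θ hk rfl hmu).symm
    _ ≤ upperLogQuantumFunctional θ t :=
        weightedPartitionEntropy_le_upperLogQuantumFunctional schurWeyl_isotypicSum_eq_zero_holds.{0} hθ
          (Nat.mul_pos hk hn) hadmt

/-- **`E_θ` is monotone under domination of occurring triples** (`θ` in the probability simplex),
by `E_θ = E^θ` (CVZ Thm. 3.30, `upperLogQuantumFunctional_eq_logQuantumFunctional`).
[cite: ChristandlVranaZuiddam2023, Thm. 3.30] -/
theorem logQuantumFunctional_le_of_dominated [DecidableEq ι] [DecidableEq κ] [DecidableEq μ]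
    [DecidableEq ι'] [DecidableEq κ'] [DecidableEq μ'] {θ : Fin 3 → ℝ} (hθ : θ ∈ stdSimplex ℝ (Fin 3))
    {s : ι → κ → μ → ℂ} {t : ι' → κ' → μ' → ℂ}
    (hdom : ∀ (n : ℕ) (lam : Fin 3 → Nat.Partition n), 0 < n →
      isotypicSum₁ (lam 0) (isotypicSum₂ (lam 1) (isotypicSum₃ (lam 2) (kroneckerPow s n))) ≠ 0 →
      ∃ (k : ℕ) (mu : Fin 3 → Nat.Partition (k * n)), 0 < k ∧
        (∀ j, (mu j).parts = (lam j).parts.map (fun p => k * p)) ∧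
        isotypicSum₁ (mu 0) (isotypicSum₂ (mu 1) (isotypicSum₃ (mu 2) (kroneckerPow t (k * n)))) ≠ 0) :
    logQuantumFunctional θ s ≤ logQuantumFunctional θ t := by
  rw [← upperLogQuantumFunctional_eq_logQuantumFunctional hθ s,
    ← upperLogQuantumFunctional_eq_logQuantumFunctional hθ t]
  exact upperLogQuantumFunctional_le_of_dominated hθ.1 hdom

/-- **The quantum functionals `F_θ = 2^{E_θ}` are monotone under domination of occurring triples**
(inclusion of moment polytopes): `F_θ(s) ≤ F_θ(t)`; for `s = 0` trivially, and `s ≠ 0` forces an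
occurring triple in degree `1`, hence (domination) one for `t`, hence `t ≠ 0`.
[cite: ChristandlVranaZuiddam2023, Def. 3.16 and Thm. 3.30]
[cite: vandenBergChristandlLysikovNieuwboerWalterZuiddam2025, §1] -/
theorem quantumFunctional_le_of_dominated [DecidableEq ι] [DecidableEq κ] [DecidableEq μ]
    [DecidableEq ι'] [DecidableEq κ'] [DecidableEq μ'] {θ : Fin 3 → ℝ} (hθ : θ ∈ stdSimplex ℝ (Fin 3))
    {s : ι → κ → μ → ℂ} {t : ι' → κ' → μ' → ℂ}
    (hdom : ∀ (n : ℕ) (lam : Fin 3 → Nat.Partition n), 0 < n →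
      isotypicSum₁ (lam 0) (isotypicSum₂ (lam 1) (isotypicSum₃ (lam 2) (kroneckerPow s n))) ≠ 0 →
      ∃ (k : ℕ) (mu : Fin 3 → Nat.Partition (k * n)), 0 < k ∧
        (∀ j, (mu j).parts = (lam j).parts.map (fun p => k * p)) ∧
        isotypicSum₁ (mu 0) (isotypicSum₂ (mu 1) (isotypicSum₃ (mu 2) (kroneckerPow t (k * n)))) ≠ 0) :
    quantumFunctional θ s ≤ quantumFunctional θ t := by
  by_cases hs : s = 0
  · subst hs
    rw [quantumFunctional_zero]
    exact quantumFunctional_nonneg θ t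
  have ht : t ≠ 0 := by
    obtain ⟨lam, hocc⟩ := exists_occurring_one_of_ne_zero hs
    obtain ⟨k, mu, hk, -, hocct⟩ := hdom 1 lam one_pos hocc
    rintro rfl
    apply hocct
    rw [kroneckerPow_zero_of_pos (Nat.mul_pos hk one_pos), isotypicSum₃_zero, isotypicSum₂_zero,
      isotypicSum₁_zero]
  rw [quantumFunctional_of_ne_zero θ hs, quantumFunctional_of_ne_zero θ ht]
  exact Real.rpow_le_rpow_of_exponent_le (by norm_num) (logQuantumFunctional_le_of_dominated hθ hdom)

/-- **The quantum functional points `F^θ` (as spectral maps) are monotone under inclusion of moment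
polytopes** — the converse/consistency half of "saturated spectral points are the quantum
functionals": for `θ` in the probability simplex and tensors `s`, `t` on finite index types, if every
triple occurring in a power of `s` has a multiple occurring in the corresponding power of `t`, then
`quantumFunctionalPoint θ s ≤ quantumFunctionalPoint θ t`.
[cite: ChristandlVranaZuiddam2023, Thm. 3.30 and Cor. 3.31]
[cite: vandenBergChristandlLysikovNieuwboerWalterZuiddam2025, §1] -/
theorem quantumFunctionalPoint_le_of_dominated {θ : Fin 3 → ℝ} (hθ : θ ∈ stdSimplex ℝ (Fin 3))
    (s : ι → κ → μ → ℂ) (t : ι' → κ' → μ' → ℂ)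
    (hdom : ∀ (n : ℕ) (lam : Fin 3 → Nat.Partition n), 0 < n →
      isotypicSum₁ (lam 0) (isotypicSum₂ (lam 1) (isotypicSum₃ (lam 2) (kroneckerPow s n))) ≠ 0 →
      ∃ (k : ℕ) (mu : Fin 3 → Nat.Partition (k * n)), 0 < k ∧
        (∀ j, (mu j).parts = (lam j).parts.map (fun p => k * p)) ∧
        isotypicSum₁ (mu 0) (isotypicSum₂ (mu 1) (isotypicSum₃ (mu 2) (kroneckerPow t (k * n)))) ≠ 0) :
    quantumFunctionalPoint θ s ≤ quantumFunctionalPoint θ t := by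
  classical
  rw [quantumFunctionalPoint_apply, quantumFunctionalPoint_apply]
  exact quantumFunctional_le_of_dominated hθ hdom

end Monotone

end Literature.Computability.AlgebraicComplexity
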